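import Summits.Parity.GeneralizedHardyLittlewood.Theorems.LiouvilleMADEngineToGHLStubRungLargeAux
import Summits.Parity.GeneralizedHardyLittlewood.Theorems.LiouvilleMADEngineToGHLStubRungAssembly

/-!
# Crux `EngineToGHL` (stmt-Parity-14995, route LiouvilleMAD), line `tuple_ladder`:
# stub `stub_rungLarge` — the large divisors of the opened `Λ(n + hs)` are negligible

The rung of the tuple ladder proves Hardy–Littlewood for `H' ∪ {hs}` from Hardy–Littlewood for
`H'` by opening `Λ(n + hs) = -∑_{d ∣ n+hs} μ(d) log d` against the tuple weight
`F(n) = ∏_{h ∈ H'} Λ(n + h) ≥ 0` and splitting the divisors at `D = ⌊N^{1-δ}⌋`.  This file is the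
registered stub `stub_rungLarge`: from the atoms hypothesis `Atoms(H', hs)` (an `ℓ¹`-level of
distribution of `λ(n + hs) F(n)` in progressions to moduli `q ≤ N^{ε₀}`, one residue and one height
per modulus, saving every power of `log N`) there is `δ ∈ (0,1)` (we take `δ = min(ε₀, 1/2)/3`) with
`∑_{n ≤ N} F(n) ∑_{d ∣ n+hs, d > D} μ(d) log d = o(N)`.

Proof.  The fixed-`N` master inequality `abs_sum_mul_sum_divisors_filter_le` of the auxiliary file
(opening `d ↦ e = (n+hs)/d`, squarefree sieve `μ = λ · ∑_{k² ∣ ·} μ(k)`, moduli `q = k² e`, partial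
summation for `k ≤ K`, trivial bound for `k > K`) is fed with: the weight bound
`0 ≤ F(n) ≤ log(N + S)^t` (`t = #H'`, `S = hs + ∑ H'`, `Λ ≤ log`); the heights `y_q ≤ N` maximising
the partial sums `|∑_{n ≤ y, q ∣ n+hs} λ(n+hs) F(n)|` (`Finset.exists_max_image`) and the residues
`w_q = q - hs mod q` (`q ∣ n + hs ↔ n ≡ w_q (mod q)`, `dvd_add_iff_modEq` of the assembly stub's
file), so that the atoms
hypothesis at exponent `A = t + 5` bounds `∑_{q ≤ N^{ε₀}} M_q ≤ C N/(log N)^{t+5}`; the cut-off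
`K = ⌊(log N)^{t+3}⌋ + 1`; and the level `K² E ≤ ⌊N^{ε₀}⌋` (`E ≤ 2N^δ`, `δ ≤ ε₀/3`,
`(log N)^{2t+6} ≤ N^{ε₀/3}` eventually).  Both resulting terms are `≪ N/log N`. [folklore]
-/

noncomputable section

open Finset Real ArithmeticFunction Filter
open scoped ArithmeticFunction.Moebius

namespace Summit.Parity.GeneralizedHardyLittlewood.Theorems.EngineToGHL.TupleLadder

open Literature.NumberTheory.LFunctions.SelbergDelange.DivisorBounds (log_natCast_mono)

/-- Numerics of the main range `k ≤ K`: `2 L₁ K Σ ≤ ε N/2` once `L₁ ≤ 2ℓ`, `0 ≤ K ≤ 2ℓ^{t+3}`,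
`0 ≤ Σ ≤ C N/ℓ^{t+5}` and `ℓ ≥ 16 C/ε` (`ℓ = log N ≥ 1`; no sign condition on `C`). [folklore] -/
theorem main_range_numerics {ℓ L₁ K SM C ε N : ℝ} {t : ℕ} (hℓ : 1 ≤ ℓ) (hε : 0 < ε) (hN : 0 ≤ N)
    (hL₁ : L₁ ≤ 2 * ℓ) (hK0 : 0 ≤ K) (hK : K ≤ 2 * ℓ ^ (t + 3))
    (hSM0 : 0 ≤ SM) (hSM : SM ≤ C * N / ℓ ^ (t + 5)) (hlog : 16 * C / ε ≤ ℓ) :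
    2 * L₁ * K * SM ≤ ε * N / 2 := by
  have hℓ0 : 0 < ℓ := by linarith
  have h16 : 16 * C ≤ ℓ * ε := (div_le_iff₀ hε).mp hlog
  calc 2 * L₁ * K * SM ≤ 2 * (2 * ℓ) * (2 * ℓ ^ (t + 3)) * (C * N / ℓ ^ (t + 5)) := by gcongr
    _ = 8 * C * N / ℓ := by
        field_simp
        ring
    _ ≤ ε * N / 2 := by
        rw [div_le_iff₀ hℓ0]
        nlinarith [mul_le_mul_of_nonneg_right h16 hN]

/-- Numerics of the tail `k > K`: `L₂^t L₁ A (1 + G) · 2/(K+1) ≤ ε N/2` once `L₁, L₂, G ≤ 2ℓ`,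
`A ≤ 2N`, `K > ℓ^{t+3}` and `ℓ ≥ 2^{t+6}/ε` (`ℓ = log N ≥ 1`). [folklore] -/
theorem tail_numerics {ℓ L₁ L₂ A G K ε N : ℝ} {t : ℕ} (hℓ : 1 ≤ ℓ) (hε : 0 < ε) (hN : 0 ≤ N)
    (hL₁0 : 0 ≤ L₁) (hL₁ : L₁ ≤ 2 * ℓ) (hL₂0 : 0 ≤ L₂) (hL₂ : L₂ ≤ 2 * ℓ) (hA0 : 0 ≤ A)
    (hA : A ≤ 2 * N) (hG0 : 0 ≤ G) (hG : G ≤ 2 * ℓ) (hK : ℓ ^ (t + 3) < K)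
    (hlog : (2 : ℝ) ^ (t + 6) / ε ≤ ℓ) :
    L₂ ^ t * L₁ * A * (1 + G) * (2 / (K + 1)) ≤ ε * N / 2 := by
  have hℓ0 : 0 < ℓ := by linarith
  have h64 : 2 ^ t * 64 ≤ ℓ * ε := by
    have h := (div_le_iff₀ hε).mp hlog
    rw [pow_add] at h
    norm_num at h
    exact h
  have hK0 : 0 < K := (pow_pos hℓ0 _).trans hK
  have hK1 : ℓ ^ (t + 3) ≤ K + 1 := by linarith
  have hG3 : 1 + G ≤ 3 * ℓ := by linarith
  calc L₂ ^ t * L₁ * A * (1 + G) * (2 / (K + 1))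
      ≤ (2 * ℓ) ^ t * (2 * ℓ) * (2 * N) * (3 * ℓ) * (2 / ℓ ^ (t + 3)) := by gcongr
    _ = 24 * 2 ^ t * N / ℓ := by
        field_simp
        ring
    _ ≤ ε * N / 2 := by
        rw [div_le_iff₀ hℓ0]
        nlinarith [mul_le_mul_of_nonneg_right h64 hN, mul_nonneg (pow_nonneg zero_le_two t) hN]

/-- **`stub_rungLarge`** (registered stub of the line `tuple_ladder`, crux stmt-Parity-14995).  From
the atoms hypothesis `Atoms(H', hs)`: `∃ ε₀ > 0 ∀ A > 0 ∃ C N₀ ∀ N ≥ N₀ ∀ w y, (∀ q, y q ≤ N) →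
∑_{q ≤ ⌊N^{ε₀}⌋} |∑_{n ≤ y q, n ≡ w q (q)} λ(n+hs) ∏_{h' ∈ H'} Λ(n+h')| ≤ C N/(log N)^A`, there is
`δ ∈ (0, 1)` such that for every `ε > 0`, eventually in `N`,
`|∑_{n ≤ N} (∏_{h ∈ H'} Λ(n+h)) ∑_{d ∣ n+hs, d > ⌊N^{1-δ}⌋} μ(d) log d| ≤ ε N`. [folklore] -/
theorem stub_rungLarge : ∀ (H' : Finset ℕ) (hs : ℕ), (∃ ε₀ : ℝ, 0 < ε₀ ∧ ∀ A : ℝ, 0 < A → ∃ C : ℝ, ∃ N₀ : ℕ, ∀ N : ℕ, N₀ ≤ N → ∀ w y : ℕ → ℕ, (∀ q, y q ≤ N) → (∑ q ∈ Finset.Icc 1 ⌊(N : ℝ) ^ ε₀⌋₊, |∑ n ∈ (Finset.Icc 1 (y q)).filter (fun n : ℕ => n ≡ w q [MOD q]), (ArithmeticFunction.liouville (n + hs) : ℝ) * ∏ h' ∈ H', ArithmeticFunction.vonMangoldt (n + h')|) ≤ C * N / Real.log N ^ A) → (∃ δ : ℝ, 0 < δ ∧ δ < 1 ∧ ∀ ε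 : ℝ, 0 < ε → ∃ N₀ : ℕ, ∀ N : ℕ, N₀ ≤ N → |∑ n ∈ Finset.Icc 1 N, (∏ h ∈ H', ArithmeticFunction.vonMangoldt (n + h)) * ∑ d ∈ (n + hs).divisors.filter (fun d : ℕ => ⌊(N : ℝ) ^ (1 - δ)⌋₊ < d), (ArithmeticFunction.moebius d : ℝ) * Real.log d| ≤ ε * N) := by
  intro H' hs hAt
  obtain ⟨ε₀, hε₀, hAt⟩ := hAt
  -- The parameters `t = #H'`, `δ = min(ε₀, 1/2)/3`, `S = hs + ∑ H'`.
  set t : ℕ := H'.card with ht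
  set δ : ℝ := min ε₀ (1 / 2) / 3 with hδ
  have hmin0 : 0 < min ε₀ (1 / 2) := lt_min hε₀ (by norm_num)
  have hminl : min ε₀ (1 / 2) ≤ ε₀ := min_le_left _ _
  have hminr : min ε₀ (1 / 2) ≤ 1 / 2 := min_le_right _ _
  have hδ0 : 0 < δ := by positivity
  have hδ1 : δ < 1 := by rw [hδ]; linarith
  have hδε : δ ≤ ε₀ / 3 := by rw [hδ]; linarith
  refine ⟨δ, hδ0, hδ1, fun ε hε => ?_⟩
  obtain ⟨C, N₁, hC⟩ := hAt ((t : ℝ) + 5) (by positivity)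
  set S : ℕ := hs + ∑ h ∈ H', h with hS
  -- Eventual conditions on `N`.
  have hlogT : Tendsto (fun N : ℕ => Real.log (N : ℝ)) atTop atTop :=
    Real.tendsto_log_atTop.comp tendsto_natCast_atTop_atTop
  have hpowT : Tendsto (fun N : ℕ => (N : ℝ) ^ (ε₀ / 3)) atTop atTop :=
    (tendsto_rpow_atTop (by positivity)).comp tendsto_natCast_atTop_atTop
  have hlo : ∀ᶠ N : ℕ in atTop, Real.log (N : ℝ) ^ (2 * t + 6) ≤ (N : ℝ) ^ (ε₀ / 3) := by
    have h := ((isLittleO_log_rpow_rpow_atTop ((2 * t + 6 : ℕ) : ℝ)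
      (by positivity : 0 < ε₀ / 3)).comp_tendsto tendsto_natCast_atTop_atTop).eventuallyLE
    filter_upwards [h] with N hN
    simp only [Function.comp, Real.rpow_natCast, Real.norm_eq_abs] at hN
    rwa [abs_of_nonneg (pow_nonneg (Real.log_natCast_nonneg N) _),
      abs_of_nonneg (Real.rpow_nonneg (Nat.cast_nonneg N) _)] at hN
  have hev : ∀ᶠ N : ℕ in atTop, N₁ ≤ N ∧ S ≤ N ∧ 3 ≤ N ∧ 16 * C / ε ≤ Real.log (N : ℝ) ∧
      (2 : ℝ) ^ (t + 6) / ε ≤ Real.log (N : ℝ) ∧ Real.log (N : ℝ) ^ (2 * t + 6) ≤ (N : ℝ) ^ (ε₀ / 3) ∧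
      (9 : ℝ) ≤ (N : ℝ) ^ (ε₀ / 3) := by
    filter_upwards [eventually_ge_atTop N₁, eventually_ge_atTop S, eventually_ge_atTop 3,
      hlogT.eventually_ge_atTop (16 * C / ε), hlogT.eventually_ge_atTop ((2 : ℝ) ^ (t + 6) / ε),
      hlo, hpowT.eventually_ge_atTop 9] with N h1 h2 h3 h4 h5 h6 h7
    exact ⟨h1, h2, h3, h4, h5, h6, h7⟩
  obtain ⟨N₀, hN₀⟩ := eventually_atTop.mp hev
  refine ⟨N₀, fun N hN => ?_⟩
  obtain ⟨hNN₁, hSN, hN3, hlogC, hlog2, hloN, h9⟩ := hN₀ N hN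
  -- From here on `N` is fixed.  The partial sums `P q y = ∑_{n ≤ y, q ∣ n+hs} λ(n+hs) F(n)`,
  -- the maximising heights `y q ≤ N`, and the atoms hypothesis at the residues `q - hs % q`.
  obtain ⟨P, hP⟩ : ∃ P : ℕ → ℕ → ℝ, ∀ q y, P q y = ∑ n ∈ (Icc 1 y).filter (fun n => q ∣ n + hs),
      (liouville (n + hs) : ℝ) * ∏ h ∈ H', Λ (n + h) := ⟨_, fun _ _ => rfl⟩
  have hy : ∀ q : ℕ, ∃ y₀ ∈ range (N + 1), ∀ y' ∈ range (N + 1), |P q y'| ≤ |P q y₀| :=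
    fun q => exists_max_image _ _ ⟨0, by simp⟩
  choose y hyr hymax using hy
  have hyN : ∀ q, y q ≤ N := fun q => Nat.lt_succ_iff.mp (mem_range.mp (hyr q))
  have hMq : ∀ q, ∀ y' ≤ N, |∑ n ∈ (Icc 1 y').filter (fun n => q ∣ n + hs),
      (liouville (n + hs) : ℝ) * ∏ h ∈ H', Λ (n + h)| ≤ |P q (y q)| := by
    intro q y' hy'
    rw [← hP q y']
    exact hymax q y' (mem_range.mpr (Nat.lt_succ_of_le hy'))
  have hAtN := hC N hNN₁ (fun q => q - hs % q) y hyN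
  rw [show ((t : ℝ) + 5) = ((t + 5 : ℕ) : ℝ) by push_cast; ring, Real.rpow_natCast] at hAtN
  -- Notation: `ℓ = log N`, `D = ⌊N^{1-δ}⌋`, `Q = ⌊N^{ε₀}⌋`, `K = ⌊ℓ^{t+3}⌋ + 1`.
  set ℓ : ℝ := Real.log (N : ℝ) with hℓ
  set D : ℕ := ⌊(N : ℝ) ^ (1 - δ)⌋₊ with hD
  set Q : ℕ := ⌊(N : ℝ) ^ ε₀⌋₊ with hQ
  set K : ℕ := ⌊ℓ ^ (t + 3)⌋₊ + 1 with hK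
  have hN0 : (0 : ℝ) < N := by exact_mod_cast (show 0 < N by omega)
  have hN1 : (1 : ℝ) ≤ N := by exact_mod_cast (show 1 ≤ N by omega)
  have hℓ1 : 1 ≤ ℓ :=
    Literature.NumberTheory.LFunctions.LiouvilleSum.one_le_log (by exact_mod_cast hN3)
  have hNN : N + S ≤ N * N := (show N + S ≤ 2 * N by omega).trans (Nat.mul_le_mul_right N (by omega))
  have hlogNN : Real.log ((N * N : ℕ) : ℝ) = 2 * ℓ := by
    rw [Nat.cast_mul, Real.log_mul hN0.ne' hN0.ne', two_mul]
  have hL₂ : Real.log ((N + S : ℕ) : ℝ) ≤ 2 * ℓ := (log_natCast_mono hNN).trans hlogNN.le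
  have hhsNN : N + hs ≤ N * N := le_trans (by omega) hNN
  have hL₁ : Real.log ((N + hs : ℕ) : ℝ) ≤ 2 * ℓ := (log_natCast_mono hhsNN).trans hlogNN.le
  have hlogE : Real.log (((N + hs) / (D + 1) : ℕ) : ℝ) ≤ 2 * ℓ :=
    (log_natCast_mono ((Nat.div_le_self _ _).trans hhsNN)).trans hlogNN.le
  have hA : ((N + hs : ℕ) : ℝ) ≤ 2 * N := by exact_mod_cast (show N + hs ≤ 2 * N by omega)
  -- The cut-off `K`.
  have hℓpow : 1 ≤ ℓ ^ (t + 3) := one_le_pow₀ hℓ1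
  have hKle : (K : ℝ) ≤ 2 * ℓ ^ (t + 3) := by
    rw [hK]
    push_cast
    have := Nat.floor_le (show 0 ≤ ℓ ^ (t + 3) by positivity)
    linarith
  have hKgt : ℓ ^ (t + 3) < (K : ℝ) := by
    rw [hK]
    push_cast
    exact Nat.lt_floor_add_one _
  -- The weight bound `0 ≤ F(n) ≤ log(N+S)^t` on `[1, N]`, `F(n) = ∏_{h ∈ H'} Λ(n+h)`.
  have hFb : ∀ n ∈ Icc 1 N, |∏ h ∈ H', Λ (n + h)| ≤ Real.log ((N + S : ℕ) : ℝ) ^ t := by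
    intro n hn
    rw [mem_Icc] at hn
    have hFn0 : 0 ≤ ∏ h ∈ H', Λ (n + h) := prod_nonneg fun h _ => vonMangoldt_nonneg
    rw [abs_of_nonneg hFn0, ht, ← Finset.prod_const]
    refine Finset.prod_le_prod (fun h _ => vonMangoldt_nonneg) fun h hh => ?_
    have hhS : h ≤ ∑ x ∈ H', x := Finset.single_le_sum (fun i _ => Nat.zero_le i) hh
    calc Λ (n + h) ≤ Real.log ((n + h : ℕ) : ℝ) := vonMangoldt_le_log
      _ ≤ Real.log ((N + S : ℕ) : ℝ) := log_natCast_mono (by omega)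
  -- The atoms bound `∑_{q ≤ Q} M_q ≤ C N / ℓ^{t+5}`, `M_q = |P q (y q)|`.
  have hSM : ∑ q ∈ Icc 1 Q, |P q (y q)| ≤ C * N / ℓ ^ (t + 5) := by
    have h1 : ∑ q ∈ Icc 1 Q, |P q (y q)| = ∑ q ∈ Icc 1 Q, |∑ n ∈ (Icc 1 (y q)).filter
        (fun n : ℕ => n ≡ q - hs % q [MOD q]), (liouville (n + hs) : ℝ) * ∏ h' ∈ H', Λ (n + h')| := by
      refine sum_congr rfl fun q hq => ?_
      rw [mem_Icc] at hq
      rw [hP, Finset.filter_congr (fun n _ => dvd_add_iff_modEq (d := q) (by omega) n hs)]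
    rw [h1]
    exact hAtN
  -- The level `K² E ≤ Q`, `E = (N+hs)/(D+1) ≤ 2 N^δ`.
  have hEle : (((N + hs) / (D + 1) : ℕ) : ℝ) ≤ 2 * (N : ℝ) ^ δ := by
    have hD1 : (N : ℝ) ^ (1 - δ) < (D : ℝ) + 1 := Nat.lt_floor_add_one _
    have hpos : 0 < (N : ℝ) ^ (1 - δ) := Real.rpow_pos_of_pos hN0 _
    calc (((N + hs) / (D + 1) : ℕ) : ℝ) ≤ ((N + hs : ℕ) : ℝ) / ((D + 1 : ℕ) : ℝ) := Nat.cast_div_le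
      _ ≤ (2 * N) / (N : ℝ) ^ (1 - δ) := by
          rw [Nat.cast_add_one]
          exact div_le_div₀ (by positivity) hA hpos hD1.le
      _ = 2 * (N : ℝ) ^ δ := by
          rw [div_eq_iff hpos.ne', mul_assoc, ← Real.rpow_add hN0]
          simp
  have hKQ : K ^ 2 * ((N + hs) / (D + 1)) ≤ Q := by
    have h1 : ((K ^ 2 * ((N + hs) / (D + 1)) : ℕ) : ℝ)
        ≤ 8 * ((N : ℝ) ^ (ε₀ / 3) * (N : ℝ) ^ (ε₀ / 3)) := by
      push_cast
      calc (K : ℝ) ^ 2 * (((N + hs) / (D + 1) : ℕ) : ℝ)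
          ≤ (2 * ℓ ^ (t + 3)) ^ 2 * (2 * (N : ℝ) ^ δ) := by gcongr
        _ = 8 * (ℓ ^ (2 * t + 6) * (N : ℝ) ^ δ) := by ring
        _ ≤ 8 * ((N : ℝ) ^ (ε₀ / 3) * (N : ℝ) ^ (ε₀ / 3)) := by gcongr
    have h2 : 8 * ((N : ℝ) ^ (ε₀ / 3) * (N : ℝ) ^ (ε₀ / 3)) ≤ (N : ℝ) ^ ε₀ - 1 := by
      have h3 : (N : ℝ) ^ ε₀ = (N : ℝ) ^ (ε₀ / 3) * ((N : ℝ) ^ (ε₀ / 3) * (N : ℝ) ^ (ε₀ / 3)) := by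
        rw [← Real.rpow_add hN0, ← Real.rpow_add hN0]
        congr 1
        ring
      have h4 : 1 ≤ (N : ℝ) ^ (ε₀ / 3) * (N : ℝ) ^ (ε₀ / 3) :=
        one_le_mul_of_one_le_of_one_le (Real.one_le_rpow hN1 (by positivity))
          (Real.one_le_rpow hN1 (by positivity))
      rw [h3]
      nlinarith [mul_le_mul_of_nonneg_right h9 (zero_le_one.trans h4)]
    have h5 : (N : ℝ) ^ ε₀ < (Q : ℝ) + 1 := Nat.lt_floor_add_one _
    have h6 : ((K ^ 2 * ((N + hs) / (D + 1)) : ℕ) : ℝ) < (Q : ℝ) := by linarith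
    exact_mod_cast h6.le
  -- The master inequality and the numerics.
  have hmaster := abs_sum_mul_sum_divisors_filter_le (fun n => ∏ h ∈ H', Λ (n + h)) N hs D K Q
    (Real.log ((N + S : ℕ) : ℝ) ^ t) (fun q => |P q (y q)|)
    (pow_nonneg (Real.log_natCast_nonneg _) t) hFb hMq hKQ
  refine hmaster.trans ?_
  calc _ ≤ ε * N / 2 + ε * N / 2 :=
        add_le_add
          (main_range_numerics hℓ1 hε hN0.le hL₁ (Nat.cast_nonneg K) hKle
            (sum_nonneg fun q _ => abs_nonneg _) hSM hlogC)
          (tail_numerics hℓ1 hε hN0.le (Real.log_natCast_nonneg _) hL₁ (Real.log_natCast_nonneg _)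
            hL₂ (Nat.cast_nonneg _) hA (Real.log_natCast_nonneg _) hlogE hKgt hlog2)
    _ = ε * N := by ring

end Summit.Parity.GeneralizedHardyLittlewood.Theorems.EngineToGHL.TupleLadder
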